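import Summits.BirchSwinnertonDyer.BirchSwinnertonDyer.Theorems.GenusKolyvaginAtTwoMinimalTwinBSDTwoTwinExistence
import Summits.BirchSwinnertonDyer.BirchSwinnertonDyer.Theorems.GenusKolyvaginAtTwoMinimalTwinBSDTwoSwappedPairExactDescent
import Summits.BirchSwinnertonDyer.BirchSwinnertonDyer.Theorems.GenusKolyvaginAtTwoMinimalTwinBSDTwoConverseSupplies
import Summits.BirchSwinnertonDyer.BirchSwinnertonDyer.Theorems.KolyvaginRankRigidityAtTwoKolyvaginBoundedDefectAtTwoDepthZero
import Summits.BirchSwinnertonDyer.BirchSwinnertonDyer.Theorems.GenusKolyvaginAtTwoMinimalTwinBSDTwoIdentityDoorSha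
import Summits.BirchSwinnertonDyer.BirchSwinnertonDyer.Theorems.GenusKolyvaginAtTwoMinimalTwinBSDTwoSwappedPairSilent
import HarnessLib

/-!
# Route `GenusKolyvaginAtTwo`, crux U₂ `MinimalTwinBSDTwo` (stmt-BirchSwinnertonDyer-22985), LINE 23 «twin_swap» v2.2 «UNIFORM»:
# ONE CELL, ONE ENGINE, ONE RESEARCH STATEMENT — U₂ ⟸ wall + rank-zero 2-converse + the 2-primary Gross–Zagier index relation KEX + PRINT,
# and KEX is LOSSLESS (U₂ + wall + PRINT ⟹ KEX)

Seat `bsd-line-gk2-p2` g27 (PROVER seat 2/3, cell `bsd-f1-sign2`, LINE 23 holder), `--supports stmt-BirchSwinnertonDyer-22985` (helper; closes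
nothing).  THEOREMS ONLY (no definition, no named fact, no `sorry`); standard axioms.  **BSD is NOT proved by this file; U₂, the wall, the
2-converse and KEX are NOT proved; no item is closed.**  Every theorem is CONDITIONAL on its displayed hypotheses.

THE POINT (planner currency).  Skeleton v2.1 (g26) proves U₂ by the trichotomy `Δ < 0` ∨ egg ∨ identity locus, with THREE research stubs
EXP⁻_all, EXP⁺_all, KEX_id — one `2`-adic exponent of the Heegner point `P(1)` per door class.  But g26 also left two UNIFORM bricks:
THE TWIN EXISTS (`IdentityDoor.exists_primeHeegner_selmerTrivial_minimalTwin_of_rank_one`, p782923, UNCONDITIONAL: every globally minimal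
rank-`1` curve with `#Sel₂ = 2` has a prime Heegner field `ℚ(√−ℓ)` with `2` split and a GLOBALLY MINIMAL `2`-SELMER-TRIVIAL twin — the trichotomy
lives INSIDE that theorem) and the SIGN-FREE, BUDGET-FREE swapped exact descent at arbitrary `Ш`-depth
(`IdentityDoor.swappedPairDescentAtTwo_shaDepth_of_facts`, p778694, with its losslessness `IdentityDoor.natCard_sha_mul_eq_of_bsdp`).  Hence:

* §1 ★ `bsdp_of_wall_of_converse_of_kex_of_facts` — **U₂ (every non-CM globally minimal `W` with `r_an = 1`, `#Sel₂(W) = 2`: `BSD₂(W)`) ⟸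
  S1 (the rank-zero `2`-Selmer-trivial wall) + CONV₀ (the rank-zero `2`-converse on all non-CM globally minimal curves) + KEX + PRINT**, where
  **KEX** (`hKEX`, ONE displayed research hypothesis, no sign / egg / image / Tamagawa case) = «for such `W`, at EVERY imaginary quadratic
  `K = ℚ(√−ℓ)` (`ℓ` prime, `d_K` odd `≠ −3`, Heegner for `N_W`, `2` split), EVERY globally minimal `Wd ≅ W^{(d_K)}` with `#Sel₂(Wd) = 1`,
  `L(W^{(d_K)},1) ≠ 0`, and EVERY conductor-`1` datum: SOME exact depth `2^{M₀} ∥ P(1)` has `#Ш(W_K)[2^∞] · 4^{ord₂ c + ord₂ C(W)} = 4^{M₀}`»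
  — the `2`-primary Gross–Zagier/Kolyvagin index relation for the rank-ONE member (Gross's Conjecture (GZ V (2.2)) at `p = 2`; the currency of
  the route's rank-zero exactness items Q3R_T/Q4_T).  No trichotomy in the proof: twin ⟶ `L`-value (CONV₀) ⟶ datum ⟶ `P(1)` non-torsion (GZ)
  ⟶ KEX ⟶ `BSD₂(Wd)` (S1) ⟶ sha-depth descent.
* §2 ★ `kex_of_bsdp_pair_of_facts` / ★ `kexAll_of_minimalTwinBSDTwo_of_wall_of_facts` — **LOSSLESSNESS**: on every such frame `BSD₂(W) ∧ BSD₂(Wd)`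
  + PRINT give KEX (the exact depth `M₀` of the non-torsion `P(1)` EXISTS — Mordell–Weil over `K[1]` + Krull, the tree's `KolyvaginAtTwo.exists_exactTwoDepth` —
  and `natCard_sha_mul_eq_of_bsdp` prices it); so **U₂ + S1 + PRINT ⟹ KEX**: the single stub carries no slack.
* §3 DICTIONARY (the three door classes of v2.1, by the tree's UNCONDITIONAL K-side `Ш` counts): on a one-bit frame (`Δ < 0`,
  `ord₂ C(Wd) ≤ ord₂ C(W) + 1`; `OneBit`) and on a silent frame (`ord₂ C(Wd) = ord₂ C(W)`; `Silent`) KEX reads `2^{ord₂ c + ord₂ C(W)} ∥ P(1)`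
  (= EXP∓_all there); on an identity-prime frame (gk2-p3 g33 `IdentityDoorSha`, `#Ш(W_K)[2^∞] = 4`) it reads `2^{ord₂ c + ord₂ C(W) + 1} ∥ P(1)`.

So (v2.2): **hTw ⟸ WALL row 1 (19095–19098) + CONV₀ (19218 ∧ 19219 + off-semistable residual) + KEX + PRINT×5** — FIVE stubs, ONE of them
research content, and that one is EQUIVALENT to U₂ modulo S1 + PRINT.  Nothing here is progress on BSD.

References: [GrossZagier1986] I.(6.3), V.§2 (2.2)–(2.3); [GrossLMS1991] §1, §2 (2.3), §5 Prop. 5.3; [McCallumLMS1991] §5 Lemma 5.1;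
[Kramer1981] Thm. 1, §2 Props. 3, 6; [MazurRubin2010] Thm. 1.5, Prop. 3.3; [Milne1972ArithmeticAV] §1 Thm. 1; [BCDTJAMS2001] Thm. A;
[SilvermanAEC2009] VIII.6.7, X.4.2; [Miller2011LMS] Def. 1.1.
-/

set_option autoImplicit false
set_option linter.dupNamespace false -- `Summit.<P>.<Sub>` repeats `BirchSwinnertonDyer` (D-0017)

noncomputable section

open scoped Classical

open WeierstrassCurve NumberField Literature.NumberTheory.EllipticCurves
  Literature.NumberTheory.EllipticCurves.ModularForms
  Literature.NumberTheory.EllipticCurves.Rank1Residual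
  Summit.BirchSwinnertonDyer.Rank1Residual
  Summit.BirchSwinnertonDyer.Rank1Residual.AdditivePotMult
  Summit.BirchSwinnertonDyer.Rank1Residual.F1Sign2
  Summit.BirchSwinnertonDyer.BirchSwinnertonDyer.Rank1Residual
  Summit.BirchSwinnertonDyer.BirchSwinnertonDyer.Theorems
  Summit.BirchSwinnertonDyer.BirchSwinnertonDyer.Theorems.GenusExact.TwinSwap

open Summit.BirchSwinnertonDyer.BirchSwinnertonDyer.Theorems.GenusExact.TwinSwap.Ledger.Line25
  (entireLFunction_twist_one_ne_zero_of_rankZeroTwoConverse_of_natCard_selmerGroup_eq_one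
    exists_kolyvaginHeegnerData_one_of_nonempty_modularParametrizationData not_isOfFinAddOrder_derivedPoint_one_of_rankOne_of_lValue_ne_zero)
open Summit.BirchSwinnertonDyer.BirchSwinnertonDyer.Theorems.GenusExact.TwinSwap.IdentityDoor
  (exists_primeHeegner_selmerTrivial_minimalTwin_of_rank_one swappedPairDescentAtTwo_shaDepth_of_facts natCard_sha_mul_eq_of_bsdp)
open Summit.BirchSwinnertonDyer.BirchSwinnertonDyer.Theorems.KolyvaginAtTwo (exists_exactTwoDepth)
open Summit.BirchSwinnertonDyer.BirchSwinnertonDyer.Theorems.GenusExact.TwinSwap.OneBit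
  (natCard_primaryComponent_sha_baseChange_two_eq_one_of_swappedPair_of_le_succ)
open Summit.BirchSwinnertonDyer.BirchSwinnertonDyer.Theorems.GenusExact.TwinSwap.Silent
  (natCard_primaryComponent_sha_baseChange_two_eq_one_of_swappedPair_silent)
open Summit.BirchSwinnertonDyer.BirchSwinnertonDyer.Theorems.GenusExact.TwinSwap.IdentityDoorSha
  (natCard_primaryComponent_sha_baseChange_two_eq_four_of_identityDoor)
open Summit.BirchSwinnertonDyer.Rank1Residual.F1Sign2 (MeetsEgg selmerGroupRelaxedAtInfinityAtTwo)

namespace Summit.BirchSwinnertonDyer.BirchSwinnertonDyer.Theorems.GenusExact.TwinSwap.Uniform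

/-! ## §1 The uniform cell: U₂ ⟸ wall + converse + KEX + PRINT -/

/-- ★ **U₂ FROM THE WALL, THE RANK-ZERO 2-CONVERSE AND THE 2-PRIMARY GROSS–ZAGIER INDEX RELATION — ONE CELL, NO TRICHOTOMY.**  Hypotheses: the
four PRINT facts + the modular parametrisation (`hGZ` Gross–Zagier at every level, `hGZK` Gross–Zagier–Kolyvagin, `hmod` modularity, `hMilneC`
Milne 1972 any model, `hMP` BCDT); `hS1` = S1 (BSD₂ for non-CM rank-`0` curves with `#Sel₂ = 1` — the four WALL items by reduction type at `2`);
`hC0` = the rank-zero `2`-converse on all non-CM globally minimal curves (items 19218 + 19219 + the off-semistable residual); `hKEX` = KEX: for `W`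
non-CM globally minimal, `r_an = 1`, `#Sel₂ = 2`, at EVERY `K = ℚ(√−ℓ)` (`ℓ` prime, `d_K` odd `≠ −3`, Heegner, `2` split), EVERY globally minimal
`Wd ≅ W^{(d_K)}` with `#Sel₂(Wd) = 1`, `L(W^{(d_K)},1) ≠ 0`, EVERY conductor-`1` datum: `∃ M₀`, `2^{M₀} ∥ P(1)` and
`#Ш(W_K)[2^∞] · 2^{2(ord₂ c + ord₂ C(W))} = 2^{2M₀}`.  CONCLUSION: `BSD₂(W)` for EVERY non-CM globally minimal `W` with `r_an = 1`, `#Sel₂ = 2`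
(= U₂ unfolded).  Proof: rank `1` (GZK); THE TWIN EXISTS (p782923); `#Sel₂(Wd) = 1` + `hC0` give `L(W^{(d_K)},1) ≠ 0` (p775371), so `r_an(Wd) = 0`
and `BSD₂(Wd)` by S1; a conductor-`1` datum (BCDT), `P(1)` of infinite order (Gross–Zagier); KEX; the sha-depth swapped exact descent (p778694).
CONDITIONAL on the displayed hypotheses; proves nothing about BSD; closes nothing.
[cite: GrossZagier1986, V.§2 (2.2)] [cite: GrossLMS1991, §2 (2.3), §5 Prop. 5.3] [cite: McCallumLMS1991, §5 Lemma 5.1]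
[cite: MazurRubin2010, Thm. 1.5, Prop. 3.3] [cite: Milne1972ArithmeticAV, §1 Thm. 1] [cite: BCDTJAMS2001, Thm. A] [cite: Miller2011LMS, Def. 1.1] -/
theorem bsdp_of_wall_of_converse_of_kex_of_facts
    (hGZ : ∀ (N : ℕ) [NeZero N] (W : WeierstrassCurve ℚ) (K : Type) [Field K] [NumberField K], gross_zagier N W K)
    (hGZK : rank_eq_analyticRank_of_analyticRank_le_one) (hmod : hasEntireLFunction_rat)
    (hMilneC : Milne1972.bsdQuotient_baseChange_quadratic_anyModel) (hMP : nonempty_modularParametrizationData)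
    (hS1 : ∀ (W : WeierstrassCurve ℚ) [W.IsElliptic] [W.IsGloballyMinimal],
      ¬ W.HasCM → W.analyticRank = 0 → Nat.card (W.selmerGroup 2) = 1 → BSDp W 2)
    (hC0 : ∀ (V : WeierstrassCurve ℚ) [V.IsElliptic] [V.IsGloballyMinimal], ¬ V.HasCM → V.selmerCorank 2 = 0 → V.analyticRank = 0)
    (hKEX : ∀ (W : WeierstrassCurve ℚ) [W.IsElliptic] [W.IsGloballyMinimal] [NeZero (W.conductorNorm ℤ)],
      ¬ W.HasCM → W.analyticRank = 1 → Nat.card (W.selmerGroup 2) = 2 →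
      ∀ (K : Type) [Field K] [NumberField K], IsImaginaryQuadratic K →
        ∀ (ℓ : ℕ), ℓ.Prime → NumberField.discr K = -(ℓ : ℤ) →
        Odd (NumberField.discr K) → NumberField.discr K ≠ -3 → SatisfiesHeegnerHypothesis (W.conductorNorm ℤ) K →
        ((Ideal.span {(2 : ℤ)}).primesOver (𝓞 K)).ncard = 2 →
        ∀ (Wd : WeierstrassCurve ℚ) [Wd.IsElliptic] [Wd.IsGloballyMinimal],
          (∃ C : VariableChange ℚ, C • W.quadraticTwist (NumberField.discr K : ℚ) = Wd) → Nat.card (Wd.selmerGroup 2) = 1 →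
        (W.quadraticTwist (NumberField.discr K : ℚ)).entireLFunction 1 ≠ 0 →
        ∀ (Dt : ModularParametrizationData W (W.conductorNorm ℤ)) (β : ℤ) (ι : K →+* ℂ) (d₁ : KolyvaginHeegnerData Dt β ι 1),
          ∃ M₀ : ℕ,
            (∃ Q : (W.baseChange (ringClassField K ι 1)).toAffine.Point, ((2 ^ M₀ : ℕ) : ℤ) • Q = d₁.derivedPoint) ∧
            (¬ ∃ Q : (W.baseChange (ringClassField K ι 1)).toAffine.Point, ((2 ^ (M₀ + 1) : ℕ) : ℤ) • Q = d₁.derivedPoint) ∧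
            Nat.card (AddCommGroup.primaryComponent (W.baseChange K).sha 2) *
                2 ^ (2 * (padicValInt 2 Dt.c + padicValNat 2 W.tamagawaProduct)) = 2 ^ (2 * M₀)) :
    ∀ (W : WeierstrassCurve ℚ) [W.IsElliptic] [W.IsGloballyMinimal], ¬ W.HasCM → W.analyticRank = 1 →
      Nat.card (W.selmerGroup 2) = 2 → BSDp W 2 := by
  intro W _ _ hcm hr hSel
  haveI : NeZero (W.conductorNorm ℤ) := ⟨(W.conductorNorm_pos_holds).ne'⟩
  -- rank one (GZK)
  have hrk : W.mordellWeilRank = 1 := by rw [(hGZK W (le_of_eq hr)).1, hr]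
  -- THE TWIN EXISTS: a prime Heegner field with `2` split and a globally minimal `2`-Selmer-trivial twin (unconditional)
  obtain ⟨K, _, _, ℓ, hℓ, hK, hd, hodd, h3, hH, h2K, Wd, _, _, ⟨Cd, hCd⟩, hSel1⟩ :=
    exists_primeHeegner_selmerTrivial_minimalTwin_of_rank_one W hrk hSel
  have hD0 : (NumberField.discr K : ℚ) ≠ 0 := by exact_mod_cast NumberField.discr_ne_zero K
  haveI := W.isElliptic_quadraticTwist hD0
  -- the central value through the rank-zero 2-converse
  have hL : (W.quadraticTwist (NumberField.discr K : ℚ)).entireLFunction 1 ≠ 0 :=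
    entireLFunction_twist_one_ne_zero_of_rankZeroTwoConverse_of_natCard_selmerGroup_eq_one hC0 hmod W hcm hD0 Wd hCd hSel1
  -- a conductor-1 datum and its Heegner point of infinite order
  obtain ⟨Dt, β, ι, d₁, hc0⟩ := exists_kolyvaginHeegnerData_one_of_nonempty_modularParametrizationData hMP W K hK hH
  have hy : ¬ IsOfFinAddOrder d₁.derivedPoint :=
    not_isOfFinAddOrder_derivedPoint_one_of_rankOne_of_lValue_ne_zero hmod W K (hGZ _ W K) hK hH hr hL d₁
  -- KEX: the exact depth and the index relation
  obtain ⟨M₀, hdiv, hndiv, hsha⟩ := hKEX W hcm hr hSel K hK ℓ hℓ hd hodd h3 hH h2K Wd ⟨Cd, hCd⟩ hSel1 hL Dt β ι d₁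
  -- the twin is non-CM of analytic rank 0: `BSD₂(Wd)` from the wall
  have hcmd : ¬ Wd.HasCM := by
    rw [← hCd, hasCM_iff_of_j_eq (((W.quadraticTwist (NumberField.discr K : ℚ)).variableChange_j Cd).trans (W.j_quadraticTwist hD0))]
    exact hcm
  have hrd : Wd.analyticRank = 0 := by
    rw [← hCd, analyticRank_smul]
    exact ((W.quadraticTwist (NumberField.discr K : ℚ)).analyticRank_eq_zero_iff_holds (hmod _)).mpr hL
  have hBd : BSDp Wd 2 := hS1 Wd hcmd hrd hSel1
  -- the sign-free, budget-free swapped exact descent at Ш-depth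
  exact swappedPairDescentAtTwo_shaDepth_of_facts hGZ hGZK hmod hMilneC W hr hSel K hK hodd h3 hH Dt hc0 β ι d₁ hy M₀ hdiv hndiv hsha
    Wd ⟨Cd, hCd⟩ hSel1 hBd

/-! ## §2 Losslessness: the BSD pair gives KEX; U₂ + S1 + PRINT ⟹ KEX -/

/-- ★ **KEX ON ONE FRAME FROM THE BSD PAIR.**  `W/ℚ` globally minimal with `r_an(W) = 1`, `#Sel₂(W) = 2`; `K` imaginary quadratic, `d_K` odd
`≠ −3`, Heegner for `N_W`; ANY conductor-`1` datum with `L(W^{(d_K)},1) ≠ 0`; `Wd` a globally minimal `2`-Selmer-trivial twin; `BSD₂(W)` and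
`BSD₂(Wd)`; PRINT `hGZ` (for `(N_W, W, K)`), `hGZK`, `hmod`, `hMilneC`.  Then **`∃ M₀`, `2^{M₀} ∥ P(1)` and
`#Ш(W_K)[2^∞] · 2^{2(ord₂ c + ord₂ C(W))} = 2^{2M₀}`**.  The exact depth exists because `P(1)` has infinite order (Gross–Zagier) in the finitely
generated group `W(K[1])` (Mordell–Weil over the ring class field, Krull's intersection theorem: the tree's `KolyvaginAtTwo.exists_exactTwoDepth`); the relation
is g26's `IdentityDoor.natCard_sha_mul_eq_of_bsdp`.  CONDITIONAL on the two `BSD₂` hypotheses and the named facts; nothing about BSD is proved.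
[cite: GrossZagier1986, I.(6.3), V.§2 (2.2)] [cite: SilvermanAEC2009, Thm. VIII.6.7] [cite: McCallumLMS1991, §5 Lemma 5.1 (proof: «M₀ is finite»)]
[cite: Milne1972ArithmeticAV, §1 Thm. 1] [cite: Miller2011LMS, Def. 1.1] -/
theorem kex_of_bsdp_pair_of_facts
    (W : WeierstrassCurve ℚ) [W.IsElliptic] [W.IsGloballyMinimal] [NeZero (W.conductorNorm ℤ)]
    (K : Type) [Field K] [NumberField K]
    (hGZ : gross_zagier (W.conductorNorm ℤ) W K) (hGZK : rank_eq_analyticRank_of_analyticRank_le_one)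
    (hmod : hasEntireLFunction_rat) (hMilneC : Milne1972.bsdQuotient_baseChange_quadratic_anyModel)
    (hr : W.analyticRank = 1) (hSel : Nat.card (W.selmerGroup 2) = 2)
    (hK : IsImaginaryQuadratic K) (hodd : Odd (NumberField.discr K)) (h3 : NumberField.discr K ≠ -3)
    (hH : SatisfiesHeegnerHypothesis (W.conductorNorm ℤ) K)
    (hL : (W.quadraticTwist (NumberField.discr K : ℚ)).entireLFunction 1 ≠ 0)
    (Dt : ModularParametrizationData W (W.conductorNorm ℤ)) (β : ℤ) (ι : K →+* ℂ) (d₁ : KolyvaginHeegnerData Dt β ι 1)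
    (Wd : WeierstrassCurve ℚ) [Wd.IsElliptic] [Wd.IsGloballyMinimal]
    (hWd : ∃ C : VariableChange ℚ, C • W.quadraticTwist (NumberField.discr K : ℚ) = Wd)
    (hSel1 : Nat.card (Wd.selmerGroup 2) = 1)
    (hBW : BSDp W 2) (hBd : BSDp Wd 2) :
    ∃ M₀ : ℕ,
      (∃ Q : (W.baseChange (ringClassField K ι 1)).toAffine.Point, ((2 ^ M₀ : ℕ) : ℤ) • Q = d₁.derivedPoint) ∧
      (¬ ∃ Q : (W.baseChange (ringClassField K ι 1)).toAffine.Point, ((2 ^ (M₀ + 1) : ℕ) : ℤ) • Q = d₁.derivedPoint) ∧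
      Nat.card (AddCommGroup.primaryComponent (W.baseChange K).sha 2) *
          2 ^ (2 * (padicValInt 2 Dt.c + padicValNat 2 W.tamagawaProduct)) = 2 ^ (2 * M₀) := by
  -- `P(1)` has infinite order (Gross–Zagier)
  have hy : ¬ IsOfFinAddOrder d₁.derivedPoint :=
    not_isOfFinAddOrder_derivedPoint_one_of_rankOne_of_lValue_ne_zero hmod W K hGZ hK hH hr hL d₁
  -- `W(K[1])` is finitely generated (Mordell–Weil over the number field `K[1]`)
  haveI := (finiteDimensional_and_isGalois_ringClassField hK ι one_ne_zero).1
  haveI : NumberField (ringClassField K ι 1) := NumberField.of_module_finite K _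
  haveI : (W.baseChange (ringClassField K ι 1)).IsElliptic := by rw [baseChange]; infer_instance
  haveI : Module.Finite ℤ (W.baseChange (ringClassField K ι 1)).toAffine.Point := by
    convert (W.baseChange (ringClassField K ι 1)).module_finite_point_holds
  -- the exact `2`-divisibility depth of `P(1)`
  obtain ⟨M₀, hdiv, hndiv⟩ := exists_exactTwoDepth
    (A := (W.baseChange (ringClassField K ι 1)).toAffine.Point) (y := d₁.derivedPoint) (by convert hy)
  have hc0 : Dt.c ≠ 0 := fun h ↦ Dt.cast_c_ne_zero (by rw [h, Int.cast_zero])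
  exact ⟨M₀, hdiv, hndiv, natCard_sha_mul_eq_of_bsdp W K hGZ hGZK hmod hMilneC hr hSel hK hodd h3 hH Dt hc0 β ι d₁ hy hdiv hndiv
    Wd hWd hSel1 hBW hBd⟩

/-- ★ **KEX IS LOSSLESS: U₂ + S1 + PRINT ⟹ KEX** (the single research hypothesis of `bsdp_of_wall_of_converse_of_kex_of_facts`, text VERBATIM).
With `hTw` = U₂ itself (BSD₂ for non-CM globally minimal rank-`1` curves with `#Sel₂ = 2`) and `hS1` = the rank-zero `2`-Selmer-trivial wall:
on every frame of KEX the twin `Wd` is non-CM (same `j`) of analytic rank `0` (`L(W^{(d_K)},1) ≠ 0`, modularity), so `BSD₂(Wd)` by S1,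
`BSD₂(W)` by U₂, and `kex_of_bsdp_pair_of_facts` gives the relation.  So modulo S1 + PRINT the stub KEX is EQUIVALENT to U₂ (with §1: and to
U₂ modulo S1 + CONV₀ + PRINT).  CONDITIONAL; proves nothing about BSD; closes nothing.
[cite: GrossZagier1986, V.§2 (2.2)] [cite: Milne1972ArithmeticAV, §1 Thm. 1] [cite: SilvermanAEC2009, X.5 Cor. 5.4.1, Thm. VIII.6.7] -/
theorem kexAll_of_minimalTwinBSDTwo_of_wall_of_facts
    (hGZ : ∀ (N : ℕ) [NeZero N] (W : WeierstrassCurve ℚ) (K : Type) [Field K] [NumberField K], gross_zagier N W K)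
    (hGZK : rank_eq_analyticRank_of_analyticRank_le_one) (hmod : hasEntireLFunction_rat)
    (hMilneC : Milne1972.bsdQuotient_baseChange_quadratic_anyModel)
    (hS1 : ∀ (W : WeierstrassCurve ℚ) [W.IsElliptic] [W.IsGloballyMinimal],
      ¬ W.HasCM → W.analyticRank = 0 → Nat.card (W.selmerGroup 2) = 1 → BSDp W 2)
    (hTw : ∀ (W : WeierstrassCurve ℚ) [W.IsElliptic] [W.IsGloballyMinimal],
      ¬ W.HasCM → W.analyticRank = 1 → Nat.card (W.selmerGroup 2) = 2 → BSDp W 2) :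
    ∀ (W : WeierstrassCurve ℚ) [W.IsElliptic] [W.IsGloballyMinimal] [NeZero (W.conductorNorm ℤ)],
      ¬ W.HasCM → W.analyticRank = 1 → Nat.card (W.selmerGroup 2) = 2 →
      ∀ (K : Type) [Field K] [NumberField K], IsImaginaryQuadratic K →
        ∀ (ℓ : ℕ), ℓ.Prime → NumberField.discr K = -(ℓ : ℤ) →
        Odd (NumberField.discr K) → NumberField.discr K ≠ -3 → SatisfiesHeegnerHypothesis (W.conductorNorm ℤ) K →
        ((Ideal.span {(2 : ℤ)}).primesOver (𝓞 K)).ncard = 2 →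
        ∀ (Wd : WeierstrassCurve ℚ) [Wd.IsElliptic] [Wd.IsGloballyMinimal],
          (∃ C : VariableChange ℚ, C • W.quadraticTwist (NumberField.discr K : ℚ) = Wd) → Nat.card (Wd.selmerGroup 2) = 1 →
        (W.quadraticTwist (NumberField.discr K : ℚ)).entireLFunction 1 ≠ 0 →
        ∀ (Dt : ModularParametrizationData W (W.conductorNorm ℤ)) (β : ℤ) (ι : K →+* ℂ) (d₁ : KolyvaginHeegnerData Dt β ι 1),
          ∃ M₀ : ℕ,
            (∃ Q : (W.baseChange (ringClassField K ι 1)).toAffine.Point, ((2 ^ M₀ : ℕ) : ℤ) • Q = d₁.derivedPoint) ∧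
            (¬ ∃ Q : (W.baseChange (ringClassField K ι 1)).toAffine.Point, ((2 ^ (M₀ + 1) : ℕ) : ℤ) • Q = d₁.derivedPoint) ∧
            Nat.card (AddCommGroup.primaryComponent (W.baseChange K).sha 2) *
                2 ^ (2 * (padicValInt 2 Dt.c + padicValNat 2 W.tamagawaProduct)) = 2 ^ (2 * M₀) := by
  intro W _ _ _ hcm hr hSel K _ _ hK ℓ _hℓ _hd hodd h3 hH _h2K Wd _ _ hWd hSel1 hL Dt β ι d₁
  obtain ⟨Cd, hCd⟩ := hWd
  have hD0 : (NumberField.discr K : ℚ) ≠ 0 := by exact_mod_cast NumberField.discr_ne_zero K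
  haveI := W.isElliptic_quadraticTwist hD0
  -- the twin is non-CM of analytic rank 0: `BSD₂(Wd)` from the wall; `BSD₂(W)` from U₂
  have hcmd : ¬ Wd.HasCM := by
    rw [← hCd, hasCM_iff_of_j_eq (((W.quadraticTwist (NumberField.discr K : ℚ)).variableChange_j Cd).trans (W.j_quadraticTwist hD0))]
    exact hcm
  have hrd : Wd.analyticRank = 0 := by
    rw [← hCd, analyticRank_smul]
    exact ((W.quadraticTwist (NumberField.discr K : ℚ)).analyticRank_eq_zero_iff_holds (hmod _)).mpr hL
  exact kex_of_bsdp_pair_of_facts W K (hGZ _ W K) hGZK hmod hMilneC hr hSel hK hodd h3 hH hL Dt β ι d₁ Wd ⟨Cd, hCd⟩ hSel1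
    (hTw W hcm hr hSel) (hS1 Wd hcmd hrd hSel1)

/-! ## §3 Dictionary: KEX on the three door classes of v2.1 (one-bit, silent, identity) -/

/-- Arithmetic of the index relation: `s · 2^{2e} = 2^{2M₀}` with `s = 1` forces `M₀ = e`, with `s = 4` forces `M₀ = e + 1`. [folklore] -/
theorem eq_of_one_mul_two_pow_two_mul_eq {e M₀ : ℕ} (h : 1 * 2 ^ (2 * e) = 2 ^ (2 * M₀)) : M₀ = e := by
  rw [one_mul] at h
  have := Nat.pow_right_injective le_rfl h
  omega

/-- Arithmetic of the index relation at an identity prime: `4 · 2^{2e} = 2^{2M₀}` forces `M₀ = e + 1`. [folklore] -/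
theorem eq_succ_of_four_mul_two_pow_two_mul_eq {e M₀ : ℕ} (h : 4 * 2 ^ (2 * e) = 2 ^ (2 * M₀)) : M₀ = e + 1 := by
  have h4 : 4 * 2 ^ (2 * e) = 2 ^ (2 * (e + 1)) := by ring
  rw [h4] at h
  have := Nat.pow_right_injective le_rfl h
  omega

/-- **DICTIONARY, ONE-BIT FRAMES (`Δ < 0`; = EXP⁻_all there).**  `W/ℚ` globally minimal, `Δ_W < 0`, rank `≥ 1`, `#Sel₂(W) = 2`; `K` imaginary
quadratic, `d_K` odd, Heegner; `Wd = Cd • W^{(d_K)}` elliptic with `#Sel₂(Wd) = 1` and the ONE-BIT budget `ord₂ C(Wd) ≤ ord₂ C(W) + 1`.  Then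
`#Ш(W_K)[2^∞] = 1` (gk2-p3 g28 / this lineage, `OneBit.natCard_primaryComponent_sha_baseChange_two_eq_one_of_swappedPair_of_le_succ`,
UNCONDITIONAL), so a KEX-shaped relation `∃ M₀, 2^{M₀} ∥ P ∧ #Ш(W_K)[2^∞] · 2^{2e} = 2^{2M₀}` for ANY point `P` of ANY group and ANY `e` reads
**`2^e ∥ P`** — on LINE 23's door-open frames (`e = ord₂ c + ord₂ C(W)`, `P = P(1)`) this is the text of EXP⁻_all.  [cite: Kramer1981, Thm. 1, §2 Prop. 3]
[cite: GrossLMS1991, §5 (5.1)–(5.3)] -/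
theorem twoDepth_eq_of_kex_of_le_succ (W : WeierstrassCurve ℚ) [W.IsElliptic] [W.IsGloballyMinimal]
    (K : Type) [Field K] [NumberField K]
    (hΔ : W.Δ < 0) (hIQ : IsImaginaryQuadratic K) (hodd : Odd (NumberField.discr K))
    (hHe : SatisfiesHeegnerHypothesis (W.conductorNorm ℤ) K)
    (hrk : 1 ≤ W.mordellWeilRank) (hSel : Nat.card (W.selmerGroup 2) = 2)
    {Wd : WeierstrassCurve ℚ} [Wd.IsElliptic] (Cd : VariableChange ℚ) (hWd : Cd • W.quadraticTwist (NumberField.discr K : ℚ) = Wd)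
    (hSel1 : Nat.card (Wd.selmerGroup 2) = 1)
    (hDEF : padicValNat 2 Wd.tamagawaProduct ≤ padicValNat 2 W.tamagawaProduct + 1)
    {A : Type*} [AddCommGroup A] (P : A) (e : ℕ)
    (hKEX : ∃ M₀ : ℕ, (∃ Q : A, ((2 ^ M₀ : ℕ) : ℤ) • Q = P) ∧ (¬ ∃ Q : A, ((2 ^ (M₀ + 1) : ℕ) : ℤ) • Q = P) ∧
      Nat.card (AddCommGroup.primaryComponent (W.baseChange K).sha 2) * 2 ^ (2 * e) = 2 ^ (2 * M₀)) :
    (∃ Q : A, ((2 ^ e : ℕ) : ℤ) • Q = P) ∧ ¬ ∃ Q : A, ((2 ^ (e + 1) : ℕ) : ℤ) • Q = P := by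
  obtain ⟨M₀, hdiv, hndiv, hrel⟩ := hKEX
  rw [(natCard_primaryComponent_sha_baseChange_two_eq_one_of_swappedPair_of_le_succ W K hΔ hIQ hodd hHe hrk hSel Cd hWd hSel1
    hDEF).2] at hrel
  obtain rfl := eq_of_one_mul_two_pow_two_mul_eq hrel
  exact ⟨hdiv, hndiv⟩

/-- **DICTIONARY, SILENT FRAMES (any sign; = EXP⁺_all on the egg).**  Same with the SILENT budget `ord₂ C(Wd) = ord₂ C(W)` and no sign
hypothesis: `#Ш(W_K)[2^∞] = 1` (`Silent.natCard_primaryComponent_sha_baseChange_two_eq_one_of_swappedPair_silent`, UNCONDITIONAL), so the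
KEX-shaped relation reads **`2^e ∥ P`** — on LINE 23's silent frames the text of EXP⁺_all.  [cite: Kramer1981, Thm. 1, §2 Props. 3, 6]
[cite: GrossLMS1991, §5 (5.1)–(5.3)] -/
theorem twoDepth_eq_of_kex_silent (W : WeierstrassCurve ℚ) [W.IsElliptic] [W.IsGloballyMinimal]
    (K : Type) [Field K] [NumberField K]
    (hIQ : IsImaginaryQuadratic K) (hodd : Odd (NumberField.discr K))
    (hHe : SatisfiesHeegnerHypothesis (W.conductorNorm ℤ) K)
    (hrk : 1 ≤ W.mordellWeilRank) (hSel : Nat.card (W.selmerGroup 2) = 2)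
    {Wd : WeierstrassCurve ℚ} [Wd.IsElliptic] (Cd : VariableChange ℚ) (hWd : Cd • W.quadraticTwist (NumberField.discr K : ℚ) = Wd)
    (hSel1 : Nat.card (Wd.selmerGroup 2) = 1)
    (hSil : padicValNat 2 Wd.tamagawaProduct = padicValNat 2 W.tamagawaProduct)
    {A : Type*} [AddCommGroup A] (P : A) (e : ℕ)
    (hKEX : ∃ M₀ : ℕ, (∃ Q : A, ((2 ^ M₀ : ℕ) : ℤ) • Q = P) ∧ (¬ ∃ Q : A, ((2 ^ (M₀ + 1) : ℕ) : ℤ) • Q = P) ∧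
      Nat.card (AddCommGroup.primaryComponent (W.baseChange K).sha 2) * 2 ^ (2 * e) = 2 ^ (2 * M₀)) :
    (∃ Q : A, ((2 ^ e : ℕ) : ℤ) • Q = P) ∧ ¬ ∃ Q : A, ((2 ^ (e + 1) : ℕ) : ℤ) • Q = P := by
  obtain ⟨M₀, hdiv, hndiv, hrel⟩ := hKEX
  rw [(natCard_primaryComponent_sha_baseChange_two_eq_one_of_swappedPair_silent W K hIQ hodd hHe hrk hSel Cd hWd hSel1 hSil).2] at hrel
  obtain rfl := eq_of_one_mul_two_pow_two_mul_eq hrel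
  exact ⟨hdiv, hndiv⟩

/-- **DICTIONARY, IDENTITY-PRIME FRAMES (`Δ > 0`, off the egg; = KEX_id ⟺ «`2^{e+1} ∥ P`»).**  On gk2-p3 g33's frame (`W` rank `1`,
`#Sel₂(W) = 2`, `Δ > 0`, `¬ MeetsEgg`; `K = ℚ(√−ℓ)`, `d_K` odd, Heegner, `2` split; `ℓ` an identity prime with `loc_ℓ` injective on
`Sel₂^{rel ∞}(W)`) `#Ш(W_K)[2^∞] = 4` (`IdentityDoorSha.natCard_primaryComponent_sha_baseChange_two_eq_four_of_identityDoor`, UNCONDITIONAL;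
finiteness of `Ш(W_K)[2^∞]` is read off the relation itself), so the KEX-shaped relation reads **`2^{e+1} ∥ P`** — one bit deeper than on the
one-bit / silent frames.  [cite: Kramer1981, Thm. 1, Thm. 2] [cite: GrossLMS1991, §5 (5.1)–(5.3)] [cite: Cassels1962ArithmeticIV, §1] -/
theorem twoDepth_eq_succ_of_kex_identity (W : WeierstrassCurve ℚ) [W.IsElliptic] [W.IsGloballyMinimal]
    (K : Type) [Field K] [NumberField K]
    (hΔ : 0 < W.Δ) (hrk : W.mordellWeilRank = 1) (hSel : Nat.card (W.selmerGroup 2) = 2) (hegg : ¬ MeetsEgg W)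
    (hK : IsImaginaryQuadratic K) (hodd : Odd (NumberField.discr K)) (hH : SatisfiesHeegnerHypothesis (W.conductorNorm ℤ) K)
    (h2K : ((Ideal.span {(2 : ℤ)}).primesOver (𝓞 K)).ncard = 2)
    {ℓ : ℕ} [Fact ℓ.Prime] (hd : NumberField.discr K = -(ℓ : ℤ))
    (hid : Nat.card {Q : (W.baseChange ℚ_[ℓ]).toAffine.Point // 2 • Q = 0} = 4)
    (hinj : ∀ c ∈ selmerGroupRelaxedAtInfinityAtTwo W, c ∈ MazurRubin2010.strictLocalKer W ℚ_[ℓ] 2 → c = 0)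
    {A : Type*} [AddCommGroup A] (P : A) (e : ℕ)
    (hKEX : ∃ M₀ : ℕ, (∃ Q : A, ((2 ^ M₀ : ℕ) : ℤ) • Q = P) ∧ (¬ ∃ Q : A, ((2 ^ (M₀ + 1) : ℕ) : ℤ) • Q = P) ∧
      Nat.card (AddCommGroup.primaryComponent (W.baseChange K).sha 2) * 2 ^ (2 * e) = 2 ^ (2 * M₀)) :
    (∃ Q : A, ((2 ^ (e + 1) : ℕ) : ℤ) • Q = P) ∧ ¬ ∃ Q : A, ((2 ^ (e + 1 + 1) : ℕ) : ℤ) • Q = P := by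
  obtain ⟨M₀, hdiv, hndiv, hrel⟩ := hKEX
  -- finiteness of `Ш(W_K)[2^∞]` from the relation
  have hne : Nat.card (AddCommGroup.primaryComponent (W.baseChange K).sha 2) ≠ 0 := by
    intro h0
    rw [h0, zero_mul] at hrel
    exact (pow_ne_zero _ two_ne_zero) hrel.symm
  haveI : Finite (AddCommGroup.primaryComponent (W.baseChange K).sha 2) := Nat.finite_of_card_ne_zero hne
  rw [natCard_primaryComponent_sha_baseChange_two_eq_four_of_identityDoor W K hΔ hrk hSel hegg hK hodd hH h2K hd hid hinj] at hrel
  obtain rfl := eq_succ_of_four_mul_two_pow_two_mul_eq hrel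
  exact ⟨hdiv, hndiv⟩

end Summit.BirchSwinnertonDyer.BirchSwinnertonDyer.Theorems.GenusExact.TwinSwap.Uniform

end
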